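import Literature.Computability.MetaComplexity.GapMINKTNWOutputs
import Literature.Computability.Complexity.GuardedBallStages
import HarnessLib

/-!
# Hirahara's Lemma 4.6 / 4.9, existence half: the reconstruction program of the NW generator and its `K^t` bound

Topic `Literature/Computability/MetaComplexity`. The no-side of the reduction of Thm. 4.21 / Cor. 4.23
(FOCS 2018 / ECCC TR18-138). Lemma 4.6 (proof, first part): a statistical test `T` for `NW^f` yields, by
the hybrid argument and Yao's predictor, indices `i, b, c`, bits `w_{[m]∖[i]}`, a seed part and "the
hardwired table of the values of `f`" (`∑_{j<i} 2^{|Sᵢ∩Sⱼ|}` bits) from which the predictor's whole truth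
table is computed "in time roughly `poly(m, d) + poly(2^ℓ)`"; with a list-decodable code (Cor. 4.8,
Lemma 4.9) an index into the decoded list then NAMES `x`. This file builds that program as an `FP`
string function on the design of lines and derives the `K^t` upper bound for `x` under the double ruler
(`KtDoubleRuler.lean`; the oracle `T_{t₁}` is the slice of a language `TL ∈ P` at a unary budget `t₁`
computed from the ruler, so that the bound does not depend on `t₁` beyond `O(log log)`):

* contexts `ctxV = ⟨⟨1^q, 1^ℓ, 1ⁱ, 1^{t₁}, ruler⟩, raw⟩` (`raw = tables ‖ w_{≥i}`) and `ctxJ = ⟨ctxV, a⟩`;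
* `NWRec.keyBitF`, `keyF` (the key `NWStr.keyOf` of the challenge `a` for block `j`, from `lineVal` on the
  fly), `tabLenF`, `offF` (`NWStr.offsetOf`), `bitF` (the look-up `tables[off_j + ⟦key_j⟧]`), `bitsF`,
  `wtailF`, `qstrF` (the hybrid query `NWStr.hybQuery`, by `NWStr.nwOut_take_overwrite`), `memF`, `pbitF`
  (Yao's predictor `NWStr.predBit` for the test "`∉ T_{t₁}`"), `rF` (the truth table `NWStr.predTable`),
  and the program `NWRec.gN dec TL q₀ P₀` with `gN_apply`, `gN_mem_FP`;
* **`NWRec.exists_ktAt_le`** — the `K^t` bound: if entry `idx` of the decoded list of the predictor's table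
  is `x`, then `K^{q₁(…)}(x) ≤ |payload| + 2|u| + c₁`, `|payload| = |tables| + (m − i) + O(log)`.

## References

* S. Hirahara, ECCC TR18-138 (2018), Lemma 4.6 (proof), Cor. 4.8, Lemma 4.9, Lemma 4.19, proof of Thm. 4.21.
* N. Nisan, A. Wigderson, JCSS 49 (1994), Lemma 2.4; S. Arora, B. Barak, CUP 2009, §1.3 (bounded loops).
-/

noncomputable section

namespace Literature.Computability.MetaComplexity

open _root_.Computability Polynomial Complexity Complexity.Brick Complexity.Plumb Complexity.OracleCompose Complexity.HashBricks

namespace NWRec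

/-! ### Two list lemmas -/

/-- A filter-map over `range` is a `ccat` of conditional singletons. [folklore] -/
theorem map_filter_range_eq_ccat (p : ℕ → Bool) (h : ℕ → Bool) : ∀ n : ℕ,
    ((List.range n).filter p).map h = ccat (fun t => if p t then [h t] else []) n
  | 0 => rfl
  | n + 1 => by
    rw [List.range_succ, List.filter_append, List.map_append, map_filter_range_eq_ccat p h n, ccat_succ]
    by_cases hp : p n = true <;> simp [hp]

/-- A sum over `range` of lengths is the length of a `ccat`. [folklore] -/
theorem length_ccat (g : ℕ → List Bool) : ∀ n : ℕ, (ccat g n).length = ∑ t ∈ Finset.range n, (g t).length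
  | 0 => rfl
  | n + 1 => by rw [ccat_succ, List.length_append, length_ccat g n, Finset.sum_range_succ]

/-! ### Contexts -/

/-- The parameter record `⟨1^q, ⟨1^ℓ, ⟨1ⁱ, ⟨1^{t₁}, 1^T⟩⟩⟩⟩`. [folklore] -/
def prm (q ℓ i t₁ T : ℕ) : List Bool := boolPair (ones q) (boolPair (ones ℓ) (boolPair (ones i) (boolPair (ones t₁) (ones T))))

/-- The outer context `⟨prm, raw⟩`. [folklore] -/
def ctxV (q ℓ i t₁ T : ℕ) (raw : List Bool) : List Bool := boolPair (prm q ℓ i t₁ T) raw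

/-- The inner context `⟨ctxV, a⟩` (challenge `a`). [folklore] -/
def ctxJ (q ℓ i t₁ T : ℕ) (raw a : List Bool) : List Bool := boolPair (ctxV q ℓ i t₁ T raw) a

/-- `1^q` from `ctxV`. [folklore] -/
def pQ : List Bool → List Bool := nthF 0 ∘ fstF
/-- `1^ℓ` from `ctxV`. [folklore] -/
def pL : List Bool → List Bool := nthF 1 ∘ fstF
/-- `1ⁱ` from `ctxV`. [folklore] -/
def pI : List Bool → List Bool := nthF 2 ∘ fstF
/-- `1^{t₁}` from `ctxV`. [folklore] -/
def pT1 : List Bool → List Bool := nthF 3 ∘ fstF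
/-- The ruler `1^T` from `ctxV`. [folklore] -/
def pR : List Bool → List Bool := sndPow 3 ∘ fstF

/-- The projection `pQ` evaluated on the reconstruction context. [folklore] -/
@[simp] theorem pQ_ctxV (q ℓ i t₁ T : ℕ) (raw : List Bool) : pQ (ctxV q ℓ i t₁ T raw) = ones q := by simp [pQ, ctxV, prm]
/-- The projection `pL` evaluated on the reconstruction context. [folklore] -/
@[simp] theorem pL_ctxV (q ℓ i t₁ T : ℕ) (raw : List Bool) : pL (ctxV q ℓ i t₁ T raw) = ones ℓ := by simp [pL, ctxV, prm]
/-- The projection `pI` evaluated on the reconstruction context. [folklore] -/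
@[simp] theorem pI_ctxV (q ℓ i t₁ T : ℕ) (raw : List Bool) : pI (ctxV q ℓ i t₁ T raw) = ones i := by simp [pI, ctxV, prm]
/-- The projection `pT1` evaluated on the reconstruction context. [folklore] -/
@[simp] theorem pT1_ctxV (q ℓ i t₁ T : ℕ) (raw : List Bool) : pT1 (ctxV q ℓ i t₁ T raw) = ones t₁ := by simp [pT1, ctxV, prm]
/-- The projection `pR` evaluated on the reconstruction context. [folklore] -/
@[simp] theorem pR_ctxV (q ℓ i t₁ T : ℕ) (raw : List Bool) : pR (ctxV q ℓ i t₁ T raw) = ones T := by simp [pR, ctxV, prm, sndPow]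
/-- The projection `sndF` evaluated on the reconstruction context. [folklore] -/
@[simp] theorem sndF_ctxV (q ℓ i t₁ T : ℕ) (raw : List Bool) : sndF (ctxV q ℓ i t₁ T raw) = raw := by simp [ctxV]
/-- The projection `fstF` evaluated on the indexed reconstruction context. [folklore] -/
@[simp] theorem fstF_ctxJ (q ℓ i t₁ T : ℕ) (raw a : List Bool) : fstF (ctxJ q ℓ i t₁ T raw a) = ctxV q ℓ i t₁ T raw := by simp [ctxJ]
/-- The projection `sndF` evaluated on the indexed reconstruction context. [folklore] -/
@[simp] theorem sndF_ctxJ (q ℓ i t₁ T : ℕ) (raw a : List Bool) : sndF (ctxJ q ℓ i t₁ T raw a) = a := by simp [ctxJ]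

/-- `pQ` is polynomial-time computable (`FP`). [folklore] -/
theorem pQ_mem_FP : pQ ∈ FP := comp_mem_FP (nthF_mem_FP 0) fstF_mem_FP
/-- `pL` is polynomial-time computable (`FP`). [folklore] -/
theorem pL_mem_FP : pL ∈ FP := comp_mem_FP (nthF_mem_FP 1) fstF_mem_FP
/-- `pI` is polynomial-time computable (`FP`). [folklore] -/
theorem pI_mem_FP : pI ∈ FP := comp_mem_FP (nthF_mem_FP 2) fstF_mem_FP
/-- `pT1` is polynomial-time computable (`FP`). [folklore] -/
theorem pT1_mem_FP : pT1 ∈ FP := comp_mem_FP (nthF_mem_FP 3) fstF_mem_FP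
/-- `pR` is polynomial-time computable (`FP`). [folklore] -/
theorem pR_mem_FP : pR ∈ FP := comp_mem_FP (sndPow_mem_FP 3) fstF_mem_FP

/-- All unary fields are dominated by the length of the context. [folklore] -/
theorem le_length_ctxV (q ℓ i t₁ T : ℕ) (raw : List Bool) : q + ℓ + i + t₁ + T ≤ (ctxV q ℓ i t₁ T raw).length := by
  simp only [ctxV, prm, length_boolPair, ones, List.length_replicate]; omega

/-- The same for the inner context. [folklore] -/
theorem le_length_ctxJ (q ℓ i t₁ T : ℕ) (raw a : List Bool) : q + ℓ + i + t₁ + T ≤ (ctxJ q ℓ i t₁ T raw a).length := by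
  have := le_length_ctxV q ℓ i t₁ T raw
  simp only [ctxJ, length_boolPair]; omega

/-! ### The key of the challenge for block `j` -/

/-- **One key bit**: on `⟨⟨ctxJ, 1ʲ⟩, 1ᵗ⟩`, `[a_t]` if the words of blocks `i` and `j` agree at abscissa
`t`, `ε` otherwise. [cite: Hirahara2018, Lemma 4.6 (proof, `z_{Sᵢ∩Sⱼ}`)] -/
def keyBitF : List Bool → List Bool :=
  iteFn (eqPairFn ∘ fanoutFn
      (NWLine.lineValF ∘ fanoutFn (fanoutFn (pQ ∘ fstF ∘ fstF ∘ fstF) (pI ∘ fstF ∘ fstF ∘ fstF)) sndF)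
      (NWLine.lineValF ∘ fanoutFn (fanoutFn (pQ ∘ fstF ∘ fstF ∘ fstF) (sndF ∘ fstF)) sndF))
    (headBitFn ∘ dropFn ∘ fanoutFn sndF (sndF ∘ fstF ∘ fstF)) (fun _ => [])

/-- Value of `keyBitF`. [folklore] -/
theorem keyBitF_apply (q ℓ i t₁ T : ℕ) (raw a : List Bool) (j t : ℕ) :
    keyBitF (boolPair (boolPair (ctxJ q ℓ i t₁ T raw a) (ones j)) (ones t)) =
      if LineDesign.lineVal q i t = LineDesign.lineVal q j t then [a.getD t false] else [] := by
  have hc : (eqPairFn ∘ fanoutFn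
      (NWLine.lineValF ∘ fanoutFn (fanoutFn (pQ ∘ fstF ∘ fstF ∘ fstF) (pI ∘ fstF ∘ fstF ∘ fstF)) sndF)
      (NWLine.lineValF ∘ fanoutFn (fanoutFn (pQ ∘ fstF ∘ fstF ∘ fstF) (sndF ∘ fstF)) sndF))
        (boolPair (boolPair (ctxJ q ℓ i t₁ T raw a) (ones j)) (ones t)) =
      [decide (LineDesign.lineVal q i t = LineDesign.lineVal q j t)] := by
    simp only [Function.comp_apply, fanoutFn_apply, fstF_boolPair, sndF_boolPair, fstF_ctxJ, pQ_ctxV, pI_ctxV, NWLine.lineValF_apply,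
      eqPairFn_boolPair]
    congr 1
    rw [decide_eq_decide]
    constructor
    · intro h; simpa [ones] using congrArg List.length h
    · intro h; rw [h]
  rw [keyBitF, iteFn_apply hc]
  by_cases h : LineDesign.lineVal q i t = LineDesign.lineVal q j t
  · rw [if_pos h, decide_eq_true h]
    simp only [↓reduceIte, Function.comp_apply, fanoutFn_apply, sndF_boolPair, fstF_boolPair, sndF_ctxJ, dropFn_boolPair,
      headBitFn_apply, ones, List.length_replicate]
    rw [List.getD_eq_getElem?_getD, List.headD_eq_head?_getD, List.head?_drop]
  · rw [if_neg h, decide_eq_false h]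
    simp

/-- `keyBitF ∈ FP`. [folklore] -/
theorem keyBitF_mem_FP : keyBitF ∈ FP := by
  have h3 : (fstF ∘ fstF ∘ fstF : List Bool → List Bool) ∈ FP := comp_mem_FP fstF_mem_FP (comp_mem_FP fstF_mem_FP fstF_mem_FP)
  have hq : (pQ ∘ fstF ∘ fstF ∘ fstF : List Bool → List Bool) ∈ FP := comp_mem_FP pQ_mem_FP h3
  have hi : (pI ∘ fstF ∘ fstF ∘ fstF : List Bool → List Bool) ∈ FP := comp_mem_FP pI_mem_FP h3
  refine iteFn_mem_FP (comp_mem_FP eqPairFn_mem_FP (fanoutFn_mem_FP ?_ ?_)) ?_ (const_mem_FP _)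
  · exact comp_mem_FP NWLine.lineValF_mem_FP (fanoutFn_mem_FP (fanoutFn_mem_FP hq hi) sndF_mem_FP)
  · exact comp_mem_FP NWLine.lineValF_mem_FP (fanoutFn_mem_FP (fanoutFn_mem_FP hq (comp_mem_FP sndF_mem_FP fstF_mem_FP)) sndF_mem_FP)
  · exact comp_mem_FP headBitFn_mem_FP (comp_mem_FP dropFn_mem_FP (fanoutFn_mem_FP sndF_mem_FP (comp_mem_FP sndF_mem_FP (comp_mem_FP fstF_mem_FP fstF_mem_FP))))

/-- **The key** `keyOf (word i) (word j) a` on `⟨ctxJ, 1ʲ⟩`: the concatenation fold of the `ℓ` conditional bits.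
[cite: Hirahara2018, Lemma 4.6 (proof)] -/
def keyF : List Bool → List Bool := runFold appF (pclipF 1 keyBitF) id (pL ∘ fstF ∘ fstF)

/-- Value of `keyF`. [cite: Hirahara2018, Lemma 4.6 (proof)] -/
theorem keyF_apply (q ℓ i t₁ T : ℕ) (raw a : List Bool) (j : ℕ) :
    keyF (boolPair (ctxJ q ℓ i t₁ T raw a) (ones j)) = NWStr.keyOf (LineDesign.lineWord q ℓ i) (LineDesign.lineWord q ℓ j) a := by
  have hℓ : ((pL ∘ fstF ∘ fstF) (boolPair (ctxJ q ℓ i t₁ T raw a) (ones j))).length = ℓ := by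
    simp [ones]
  have hlen : ((pL ∘ fstF ∘ fstF) (boolPair (ctxJ q ℓ i t₁ T raw a) (ones j))).length ≤ (id (boolPair (ctxJ q ℓ i t₁ T raw a) (ones j))).length := by
    rw [hℓ, id, length_boolPair]
    have := le_length_ctxJ q ℓ i t₁ T raw a
    omega
  rw [keyF, runFold_apply _ _ _ _ hlen, hℓ, id,
    foldAcc_pclipF (fun t _ _ => by rw [keyBitF_apply, length_boolPair]; split_ifs <;> simp), foldAcc_appF, List.nil_append]
  rw [show (fun t => keyBitF (boolPair (boolPair (ctxJ q ℓ i t₁ T raw a) (ones j)) (ones (0 + t)))) =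
      fun t => if LineDesign.lineVal q i t = LineDesign.lineVal q j t then [a.getD t false] else [] from
      funext fun t => by rw [Nat.zero_add, keyBitF_apply]]
  rw [NWStr.keyOf, NWStr.keyPos, LineDesign.length_lineWord]
  have hfilt : (List.range ℓ).filter (fun k => decide ((LineDesign.lineWord q ℓ j)[k]? = (LineDesign.lineWord q ℓ i)[k]?)) =
      (List.range ℓ).filter (fun t => decide (LineDesign.lineVal q i t = LineDesign.lineVal q j t)) := by
    refine List.filter_congr fun t ht => ?_
    rw [List.mem_range] at ht
    rw [List.getElem?_eq_getElem (by simpa using ht), List.getElem?_eq_getElem (by simpa using ht), LineDesign.getElem_lineWord,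
      LineDesign.getElem_lineWord]
    simp only [Option.some_inj, eq_comm]
  rw [hfilt, map_filter_range_eq_ccat]
  refine ccat_congr fun t _ => ?_
  simp only [decide_eq_true_eq]

/-- `keyF ∈ FP`. [folklore] -/
theorem keyF_mem_FP : keyF ∈ FP :=
  runFold_mem_FP appF_mem_FP (X + 0) (fun w => by simpa using length_appF_le w) (pclipF_mem_FP 1 keyBitF_mem_FP) 1
    (length_pclipF_le 1 keyBitF) (PolyTimeComputable.id _) (comp_mem_FP pL_mem_FP (comp_mem_FP fstF_mem_FP fstF_mem_FP))

/-- The key is as long as the set of agreeing abscissae. [folklore] -/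
theorem length_keyF (q ℓ i t₁ T : ℕ) (raw a : List Bool) (j : ℕ) :
    (keyF (boolPair (ctxJ q ℓ i t₁ T raw a) (ones j))).length = (NWStr.keyPos (LineDesign.lineWord q ℓ i) (LineDesign.lineWord q ℓ j)).length := by
  rw [keyF_apply, NWStr.length_keyOf]

/-- The key is at most `ℓ` bits long. [folklore] -/
theorem length_keyPos_le (q ℓ i j : ℕ) : (NWStr.keyPos (LineDesign.lineWord q ℓ i) (LineDesign.lineWord q ℓ j)).length ≤ ℓ := by
  rw [NWStr.keyPos, LineDesign.length_lineWord]
  exact (List.length_filter_le _ _).trans (by simp)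

/-! ### Powers of two under the ruler; offsets -/

/-- A concatenation of blocks of ones is the block of the sum (twin of `ccat_ones` in
`Complexity/ParsimoniousThreeCNFMachine.lean` and `Complexity/DiscreteTomographyProofs.lean`, not imported: unrelated heavy
closures; librarian consolidation candidate). [folklore] -/
theorem ccat_ones (g : ℕ → ℕ) : ∀ n : ℕ, ccat (fun j => ones (g j)) n = ones (∑ j ∈ Finset.range n, g j)
  | 0 => rfl
  | n + 1 => by rw [ccat_succ, ccat_ones g n, Finset.sum_range_succ]; simp [ones]

/-- The little-endian numeral `0^c 1` of `2^c`. [folklore] -/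
theorem bitsToNat_replicate_false_append_true (c : ℕ) : bitsToNat (List.replicate c false ++ [true]) = 2 ^ c := by
  rw [bitsToNat_append, bitsToNat_replicate_false, List.length_replicate]; simp

/-- **`2^{|key|}` in unary under the ruler**: `⟨1^T, key⟩ ↦ 1^{min (2^{|key|}) T}`. [folklore] -/
def pow2F : List Bool → List Bool := binToUnaryFn ∘ fanoutFn fstF ((fun k => Kannan.zerosFn k ++ [true]) ∘ sndF)

/-- Value of `pow2F`. [folklore] -/
theorem pow2F_apply (T : ℕ) (key : List Bool) : pow2F (boolPair (ones T) key) = ones (min (2 ^ key.length) T) := by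
  simp only [pow2F, Function.comp_apply, fanoutFn_apply, fstF_boolPair, sndF_boolPair, Kannan.zerosFn_apply, binToUnaryFn_boolPair,
    bitsToNat_replicate_false_append_true, ones, List.length_replicate]

/-- `pow2F ∈ FP`. [folklore] -/
theorem pow2F_mem_FP : pow2F ∈ FP :=
  comp_mem_FP binToUnaryFn_mem_FP (fanoutFn_mem_FP fstF_mem_FP (comp_mem_FP (append_mem_FP Kannan.zerosFn_mem_FP (const_mem_FP _)) sndF_mem_FP))

/-- **The table length `2^{|Sᵢ∩Sⱼ'|}`** on `⟨ctxJ, 1^{j'}⟩` (for `2^ℓ ≤ T`). [cite: Hirahara2018, Lemma 4.6 (proof)] -/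
def tabLenF : List Bool → List Bool := pow2F ∘ fanoutFn (pR ∘ fstF ∘ fstF) keyF

/-- The offset `∑_{j'<j} 2^{|Sᵢ ∩ Sⱼ'|}` as a number. [cite: Hirahara2018, Lemma 4.6 (proof)] -/
def offVal (q ℓ i j : ℕ) : ℕ := ∑ j' ∈ Finset.range j, 2 ^ (NWStr.keyPos (LineDesign.lineWord q ℓ i) (LineDesign.lineWord q ℓ j')).length

/-- Value of `tabLenF` (for `2^ℓ ≤ T`). [folklore] -/
theorem tabLenF_apply {q ℓ i t₁ T : ℕ} (hT : 2 ^ ℓ ≤ T) (raw a : List Bool) (j' : ℕ) :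
    tabLenF (boolPair (ctxJ q ℓ i t₁ T raw a) (ones j')) = ones (2 ^ (NWStr.keyPos (LineDesign.lineWord q ℓ i) (LineDesign.lineWord q ℓ j')).length) := by
  simp only [tabLenF, Function.comp_apply, fanoutFn_apply, fstF_boolPair, fstF_ctxJ, pR_ctxV, pow2F_apply, length_keyF]
  rw [min_eq_left ((Nat.pow_le_pow_right (by norm_num) (length_keyPos_le q ℓ i j')).trans hT)]

/-- `tabLenF ∈ FP`. [folklore] -/
theorem tabLenF_mem_FP : tabLenF ∈ FP :=
  comp_mem_FP pow2F_mem_FP (fanoutFn_mem_FP (comp_mem_FP pR_mem_FP (comp_mem_FP fstF_mem_FP fstF_mem_FP)) keyF_mem_FP)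

/-- **The offset** `1^{off_j}` on `⟨ctxJ, 1ʲ⟩` (`j ≤ i`, `2^ℓ ≤ T`): the fold of the table lengths.
[cite: Hirahara2018, Lemma 4.6 (proof)] -/
def offF : List Bool → List Bool := runFold appF (pclipF X tabLenF) fstF sndF

/-- Value of `offF`. [folklore] -/
theorem offF_apply {q ℓ i t₁ T : ℕ} (hT : 2 ^ ℓ ≤ T) (raw a : List Bool) {j : ℕ} (hj : j ≤ i) :
    offF (boolPair (ctxJ q ℓ i t₁ T raw a) (ones j)) = ones (offVal q ℓ i j) := by
  have hlen : (sndF (boolPair (ctxJ q ℓ i t₁ T raw a) (ones j))).length ≤ (fstF (boolPair (ctxJ q ℓ i t₁ T raw a) (ones j))).length := by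
    rw [sndF_boolPair, fstF_boolPair]
    have := le_length_ctxJ q ℓ i t₁ T raw a
    simp only [ones, List.length_replicate]; omega
  rw [offF, runFold_apply _ _ _ _ hlen, fstF_boolPair, sndF_boolPair]
  simp only [ones, List.length_replicate]
  rw [foldAcc_pclipF (fun j' _ _ => by
      rw [tabLenF_apply hT, eval_X]
      have := le_length_ctxJ q ℓ i t₁ T raw a
      have h2 : 2 ^ (NWStr.keyPos (LineDesign.lineWord q ℓ i) (LineDesign.lineWord q ℓ j')).length ≤ T :=
        (Nat.pow_le_pow_right (by norm_num) (length_keyPos_le q ℓ i j')).trans hT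
      simp only [ones, List.length_replicate]; omega),
    foldAcc_appF, List.nil_append]
  rw [show (fun j' => tabLenF (boolPair (ctxJ q ℓ i t₁ T raw a) (ones (0 + j')))) =
      fun j' => ones (2 ^ (NWStr.keyPos (LineDesign.lineWord q ℓ i) (LineDesign.lineWord q ℓ j')).length) from
      funext fun j' => by rw [Nat.zero_add, tabLenF_apply hT], ccat_ones]
  rfl

/-- `offF ∈ FP`. [folklore] -/
theorem offF_mem_FP : offF ∈ FP :=
  runFold_mem_FP appF_mem_FP (X + 0) (fun w => by simpa using length_appF_le w) (pclipF_mem_FP X tabLenF_mem_FP) X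
    (length_pclipF_le X tabLenF) fstF_mem_FP sndF_mem_FP

/-- The offsets are the `NWStr.offsetOf` of the design of lines (`i < m`, `j ≤ m`). [folklore] -/
theorem offVal_eq_offsetOf {q ℓ m i j : ℕ} (hi : i < m) (hj : j ≤ m) :
    offVal q ℓ i j = NWStr.offsetOf (LineDesign.lineDesign q ℓ m) i j := by
  rw [NWStr.offsetOf, LineDesign.getD_lineDesign q ℓ m hi, LineDesign.lineDesign, ← List.map_take, List.take_range, min_eq_left hj,
    List.map_map, offVal, ← List.sum_toFinset _ List.nodup_range, List.toFinset_range]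
  rfl

/-- The offsets increase by the table lengths. [folklore] -/
theorem offVal_succ (q ℓ i j : ℕ) :
    offVal q ℓ i (j + 1) = offVal q ℓ i j + 2 ^ (NWStr.keyPos (LineDesign.lineWord q ℓ i) (LineDesign.lineWord q ℓ j)).length := by
  rw [offVal, Finset.sum_range_succ, offVal]

/-- The offsets are monotone. [folklore] -/
theorem offVal_mono (q ℓ i : ℕ) {j j' : ℕ} (h : j ≤ j') : offVal q ℓ i j ≤ offVal q ℓ i j' :=
  Finset.sum_le_sum_of_subset (Finset.range_mono h)

/-- The concatenated tables have length `off_i`. [folklore] -/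
theorem length_tables_eq_offVal {q ℓ m i : ℕ} (hi : i < m) (f z : List Bool) :
    (NWStr.tables q f (LineDesign.lineDesign q ℓ m) i z).length = offVal q ℓ i i := by
  rw [NWStr.length_tables, offVal_eq_offsetOf hi hi.le]

/-! ### The look-up -/

/-- **The look-up of block `j`** on `⟨ctxJ, 1ʲ⟩`: `[raw[off_j + ⟦key_j⟧]]`.
[cite: Hirahara2018, Lemma 4.6 (proof, the hardwired table)] -/
def bitF : List Bool → List Bool :=
  headBitFn ∘ dropFn ∘ fanoutFn (fun w => offF w ++ (binToUnaryFn ∘ fanoutFn (pR ∘ fstF ∘ fstF) keyF) w) (sndF ∘ fstF ∘ fstF)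

/-- Value of `bitF` (`j ≤ i`, `2^ℓ ≤ T`). [folklore] -/
theorem bitF_apply {q ℓ i t₁ T : ℕ} (hT : 2 ^ ℓ ≤ T) (raw a : List Bool) {j : ℕ} (hj : j ≤ i) :
    bitF (boolPair (ctxJ q ℓ i t₁ T raw a) (ones j)) =
      [raw.getD (offVal q ℓ i j + bitsToNat (NWStr.keyOf (LineDesign.lineWord q ℓ i) (LineDesign.lineWord q ℓ j) a)) false] := by
  have hval : bitsToNat (NWStr.keyOf (LineDesign.lineWord q ℓ i) (LineDesign.lineWord q ℓ j) a) ≤ T := by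
    refine (bitsToNat_lt _).le.trans ?_
    rw [NWStr.length_keyOf]
    exact (Nat.pow_le_pow_right (by norm_num) (length_keyPos_le q ℓ i j)).trans hT
  simp only [bitF, Function.comp_apply, fanoutFn_apply, fstF_boolPair, fstF_ctxJ, pR_ctxV, sndF_ctxV, offF_apply hT raw a hj,
    keyF_apply, binToUnaryFn_boolPair]
  rw [show ones (offVal q ℓ i j) ++ ones (min (bitsToNat (NWStr.keyOf (LineDesign.lineWord q ℓ i) (LineDesign.lineWord q ℓ j) a)) (ones T).length) =
      ones (offVal q ℓ i j + bitsToNat (NWStr.keyOf (LineDesign.lineWord q ℓ i) (LineDesign.lineWord q ℓ j) a)) by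
      simp only [ones, List.length_replicate, min_eq_left hval, List.replicate_append_replicate],
    dropFn_boolPair, headBitFn_apply]
  simp only [ones, List.length_replicate]
  rw [List.getD_eq_getElem?_getD, List.headD_eq_head?_getD, List.head?_drop]

/-- `bitF ∈ FP`. [folklore] -/
theorem bitF_mem_FP : bitF ∈ FP :=
  comp_mem_FP headBitFn_mem_FP (comp_mem_FP dropFn_mem_FP (fanoutFn_mem_FP
    (append_mem_FP offF_mem_FP (comp_mem_FP binToUnaryFn_mem_FP (fanoutFn_mem_FP (comp_mem_FP pR_mem_FP (comp_mem_FP fstF_mem_FP fstF_mem_FP)) keyF_mem_FP)))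
    (comp_mem_FP sndF_mem_FP (comp_mem_FP fstF_mem_FP fstF_mem_FP))))

/-- **All look-ups** on `ctxJ`: the real part of the hybrid query. [cite: Hirahara2018, Lemma 4.6 (proof)] -/
def bitsF : List Bool → List Bool := runFold appF (pclipF 1 bitF) id (pI ∘ fstF)

/-- Value of `bitsF` (`2^ℓ ≤ T`). [folklore] -/
theorem bitsF_apply {q ℓ i t₁ T : ℕ} (hT : 2 ^ ℓ ≤ T) (raw a : List Bool) :
    bitsF (ctxJ q ℓ i t₁ T raw a) =
      (List.range i).map fun j => raw.getD (offVal q ℓ i j + bitsToNat (NWStr.keyOf (LineDesign.lineWord q ℓ i) (LineDesign.lineWord q ℓ j) a)) false := by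
  have hi : ((pI ∘ fstF) (ctxJ q ℓ i t₁ T raw a)).length = i := by simp [ones]
  have hlen : ((pI ∘ fstF) (ctxJ q ℓ i t₁ T raw a)).length ≤ (id (ctxJ q ℓ i t₁ T raw a)).length := by
    rw [hi, id]; have := le_length_ctxJ q ℓ i t₁ T raw a; omega
  rw [bitsF, runFold_apply _ _ _ _ hlen, hi, id,
    foldAcc_pclipF (fun j _ hj => by rw [bitF_apply hT raw a (by omega)]; simp), foldAcc_appF, List.nil_append]
  rw [ccat_congr (g' := fun j => [raw.getD (offVal q ℓ i j + bitsToNat (NWStr.keyOf (LineDesign.lineWord q ℓ i) (LineDesign.lineWord q ℓ j) a)) false])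
      (fun j hj => by rw [Nat.zero_add, bitF_apply hT raw a hj.le]),
    NWLine.ccat_singleton]

/-- `bitsF ∈ FP`. [folklore] -/
theorem bitsF_mem_FP : bitsF ∈ FP :=
  runFold_mem_FP appF_mem_FP (X + 0) (fun w => by simpa using length_appF_le w) (pclipF_mem_FP 1 bitF_mem_FP) 1
    (length_pclipF_le 1 bitF) (PolyTimeComputable.id _) (comp_mem_FP pI_mem_FP fstF_mem_FP)

/-- **The bits `w_{≥ i}`** on `ctxJ`: `raw` past the tables. [cite: Hirahara2018, Lemma 4.6 (proof, `w_{[m]∖[i]}`)] -/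
def wtailF : List Bool → List Bool := dropFn ∘ fanoutFn (offF ∘ fanoutFn id (pI ∘ fstF)) (sndF ∘ fstF)

/-- Value of `wtailF` (`2^ℓ ≤ T`). [folklore] -/
theorem wtailF_apply {q ℓ i t₁ T : ℕ} (hT : 2 ^ ℓ ≤ T) (raw a : List Bool) :
    wtailF (ctxJ q ℓ i t₁ T raw a) = raw.drop (offVal q ℓ i i) := by
  simp only [wtailF, Function.comp_apply, fanoutFn_apply, id, fstF_ctxJ, pI_ctxV, sndF_ctxV, offF_apply hT raw a le_rfl, dropFn_boolPair,
    ones, List.length_replicate]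

/-- `wtailF ∈ FP`. [folklore] -/
theorem wtailF_mem_FP : wtailF ∈ FP :=
  comp_mem_FP dropFn_mem_FP (fanoutFn_mem_FP (comp_mem_FP offF_mem_FP (fanoutFn_mem_FP (PolyTimeComputable.id _) (comp_mem_FP pI_mem_FP fstF_mem_FP)))
    (comp_mem_FP sndF_mem_FP fstF_mem_FP))

/-- **The hybrid query** `bits ‖ w_{≥ i}` on `ctxJ`. [cite: Hirahara2018, Lemma 4.6 (proof)] -/
def qstrF : List Bool → List Bool := fun w => bitsF w ++ wtailF w

/-- `qstrF ∈ FP`. [folklore] -/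
theorem qstrF_mem_FP : qstrF ∈ FP := append_mem_FP bitsF_mem_FP wtailF_mem_FP

/-- **The hybrid query is `NWStr.hybQuery`** for genuine data: design of lines with `i < m`, seed `z` of
length `ℓ q`, `raw = tables ‖ w ⇂ i`. [cite: Hirahara2018, Lemma 4.6 (proof)] -/
theorem qstrF_apply {q ℓ m i t₁ T : ℕ} (hq : 0 < q) (hT : 2 ^ ℓ ≤ T) (hi : i < m) (f z w a : List Bool) (hz : z.length = ℓ * q) :
    qstrF (ctxJ q ℓ i t₁ T (NWStr.tables q f (LineDesign.lineDesign q ℓ m) i z ++ w.drop i) a) =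
      NWStr.hybQuery q f (LineDesign.lineDesign q ℓ m) i z w a := by
  set D := LineDesign.lineDesign q ℓ m with hD
  have hiD : i < D.length := by rw [hD, LineDesign.length_lineDesign]; exact hi
  rw [qstrF, bitsF_apply hT, wtailF_apply hT, NWStr.hybQuery, ← length_tables_eq_offVal hi f z, List.drop_left,
    NWStr.nwOut_take_overwrite f D (LineDesign.wf_lineDesign hq ℓ m) hiD z a hz]
  congr 1
  refine List.map_congr_left fun j hj => ?_
  rw [List.mem_range] at hj
  rw [LineDesign.getD_lineDesign q ℓ m hi, LineDesign.getD_lineDesign q ℓ m (hj.trans hi), ← offVal_eq_offsetOf hi (hj.trans hi).le]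
  apply List.getD_append
  -- the look-up address lies inside the tables
  rw [length_tables_eq_offVal hi]
  calc offVal q ℓ i j + bitsToNat (NWStr.keyOf (LineDesign.lineWord q ℓ i) (LineDesign.lineWord q ℓ j) a)
      < offVal q ℓ i j + 2 ^ (NWStr.keyPos (LineDesign.lineWord q ℓ i) (LineDesign.lineWord q ℓ j)).length := by
        rw [Nat.add_lt_add_iff_left, ← NWStr.length_keyOf _ _ a]; exact bitsToNat_lt _
    _ = offVal q ℓ i (j + 1) := (offVal_succ q ℓ i j).symm
    _ ≤ offVal q ℓ i i := offVal_mono q ℓ i (Nat.succ_le_of_lt hj)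

/-! ### Yao's predictor bit and the truth table -/

/-- The oracle answer `[⟨qstr, 1^{t₁}⟩ ∈ TL]` on `ctxJ`. [cite: Hirahara2018, Lemma 4.6 (proof, the query to `T`)] -/
def memF (TL : Language Bool) : List Bool → List Bool := Oracle.ofLanguage TL ∘ fanoutFn qstrF (pT1 ∘ fstF)

/-- The bit `w_i`. [folklore] -/
def wiF : List Bool → List Bool := headBitFn ∘ wtailF

/-- **Yao's predictor bit** `w_i ⊕ [query ∈ T_{t₁}]` on `ctxJ` (i.e. `w_i` if the query is OUTSIDE the
slice, `¬w_i` otherwise: the predictor for the test "`∉ T_{t₁}`"). [cite: Hirahara2018, Lemma 4.6 (proof: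
"Output `T_b(…) ⊕ c ⊕ 1`")] -/
def pbitJF (TL : Language Bool) : List Bool → List Bool := xorFn (memF TL) wiF

/-- `pbitJF TL ∈ FP` for `TL ∈ P`. [folklore] -/
theorem pbitJF_mem_FP {TL : Language Bool} (hTL : TL ∈ Classes.P) : pbitJF TL ∈ FP :=
  xorFn_mem_FP (comp_mem_FP (GuardedBall.ofLanguage_mem_FP_of_mem_P hTL) (fanoutFn_mem_FP qstrF_mem_FP (comp_mem_FP pT1_mem_FP fstF_mem_FP)))
    (comp_mem_FP headBitFn_mem_FP wtailF_mem_FP)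

/-- The slice of `TL` at budget `t₁`, complemented: the test `S = {y | ⟨y, 1^{t₁}⟩ ∉ TL}`. [cite: Hirahara2018, §4.2 ("`T_t := {x | (x, 1ᵗ) ∈ T}`")] -/
def sliceCompl (TL : Language Bool) (t₁ : ℕ) : Set (List Bool) := {y | boolPair y (ones t₁) ∉ TL}

/-- Membership in the complemented slice is decided classically (the canonical instance for `NWStr.predBit`). [folklore] -/
instance sliceCompl.decidablePred (TL : Language Bool) (t₁ : ℕ) : DecidablePred (· ∈ sliceCompl TL t₁) := Classical.decPred _

open Classical in
/-- **The predictor bit is `NWStr.predBit`** for the complemented slice. [cite: Hirahara2018, Lemma 4.6 (proof)] -/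
theorem pbitJF_apply {TL : Language Bool} {q ℓ m i t₁ T : ℕ} (hq : 0 < q) (hT : 2 ^ ℓ ≤ T) (hi : i < m) (f z w a : List Bool)
    (hz : z.length = ℓ * q) :
    pbitJF TL (ctxJ q ℓ i t₁ T (NWStr.tables q f (LineDesign.lineDesign q ℓ m) i z ++ w.drop i) a) =
      [NWStr.predBit (sliceCompl TL t₁) q f (LineDesign.lineDesign q ℓ m) i z w a] := by
  have hmem : memF TL (ctxJ q ℓ i t₁ T (NWStr.tables q f (LineDesign.lineDesign q ℓ m) i z ++ w.drop i) a) =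
      [decide (boolPair (NWStr.hybQuery q f (LineDesign.lineDesign q ℓ m) i z w a) (ones t₁) ∈ TL)] := by
    simp only [memF, Function.comp_apply, fanoutFn_apply, qstrF_apply hq hT hi f z w a hz, fstF_ctxJ, pT1_ctxV, GuardedBall.ofLanguage_apply_decide]
  have hwi : wiF (ctxJ q ℓ i t₁ T (NWStr.tables q f (LineDesign.lineDesign q ℓ m) i z ++ w.drop i) a) = [w.getD i false] := by
    simp only [wiF, Function.comp_apply, wtailF_apply hT, ← length_tables_eq_offVal hi f z, List.drop_left, headBitFn_apply]
    rw [List.getD_eq_getElem?_getD, List.headD_eq_head?_getD, List.head?_drop]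
  rw [pbitJF, xorFn_apply hmem hwi, NWStr.predBit]
  have hS : (NWStr.hybQuery q f (LineDesign.lineDesign q ℓ m) i z w a ∈ sliceCompl TL t₁) ↔
      boolPair (NWStr.hybQuery q f (LineDesign.lineDesign q ℓ m) i z w a) (ones t₁) ∉ TL := Iff.rfl
  by_cases h : boolPair (NWStr.hybQuery q f (LineDesign.lineDesign q ℓ m) i z w a) (ones t₁) ∈ TL
  · rw [decide_eq_true h, if_neg (fun h' => hS.1 h' h)]; simp
  · rw [decide_eq_false h, if_pos (hS.2 h)]; simp

/-- **The challenge** `natBits ℓ v` on `⟨ctxV, 1^v⟩`: the numeral of `v` padded to `ℓ` bits. [folklore] -/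
def aF : List Bool → List Bool := takeFn ∘ fanoutFn (pL ∘ fstF) (fun w => (lenBinF ∘ sndF) w ++ (Kannan.zerosFn ∘ pL ∘ fstF) w)

/-- Padding a numeral reproduces `natBits`. [folklore] -/
theorem take_encodeNat_append_replicate {ℓ v : ℕ} (hv : v < 2 ^ ℓ) :
    (encodeNat v ++ List.replicate ℓ false).take ℓ = natBits ℓ v := by
  have hlen : (encodeNat v).length ≤ ℓ := by
    rcases Nat.eq_zero_or_pos v with rfl | hpos
    · simp [encodeNat, encodeNum]
    · have h1 := TM2Pass.length_encodeNat_le v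
      have h2 : Nat.log 2 v < ℓ := by rw [Nat.log_lt_iff_lt_pow one_lt_two hpos.ne']; exact hv
      omega
  have htake : (encodeNat v ++ List.replicate ℓ false).take ℓ = encodeNat v ++ List.replicate (ℓ - (encodeNat v).length) false := by
    rw [List.take_append, List.take_of_length_le hlen, List.take_replicate, min_eq_left (Nat.sub_le _ _)]
  have hval : bitsToNat ((encodeNat v ++ List.replicate ℓ false).take ℓ) = v := by
    rw [htake, bitsToNat_append, bitsToNat_replicate_false, bitsToNat_encodeNat]; simp
  have hl : ((encodeNat v ++ List.replicate ℓ false).take ℓ).length = ℓ := by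
    rw [htake, List.length_append, List.length_replicate]; omega
  have := CoinEnum.natBits_bitsToNat ((encodeNat v ++ List.replicate ℓ false).take ℓ)
  rw [hl, hval] at this
  exact this.symm

/-- Value of `aF` (`v < 2^ℓ`). [folklore] -/
theorem aF_apply {q ℓ i t₁ T : ℕ} (raw : List Bool) {v : ℕ} (hv : v < 2 ^ ℓ) :
    aF (boolPair (ctxV q ℓ i t₁ T raw) (ones v)) = natBits ℓ v := by
  simp only [aF, Function.comp_apply, fanoutFn_apply, fstF_boolPair, sndF_boolPair, pL_ctxV, lenBinF_apply, Kannan.zerosFn_apply, takeFn_boolPair,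
    ones, List.length_replicate, take_encodeNat_append_replicate hv]

/-- `aF ∈ FP`. [folklore] -/
theorem aF_mem_FP : aF ∈ FP :=
  comp_mem_FP takeFn_mem_FP (fanoutFn_mem_FP (comp_mem_FP pL_mem_FP fstF_mem_FP)
    (append_mem_FP (comp_mem_FP lenBinF_mem_FP sndF_mem_FP) (comp_mem_FP Kannan.zerosFn_mem_FP (comp_mem_FP pL_mem_FP fstF_mem_FP))))

/-- **The predictor bit for challenge number `v`** on `⟨ctxV, 1^v⟩`. [cite: Hirahara2018, Lemma 4.6 (proof)] -/
def pbitF (TL : Language Bool) : List Bool → List Bool := pbitJF TL ∘ fanoutFn fstF aF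

/-- `pbitF TL ∈ FP`. [folklore] -/
theorem pbitF_mem_FP {TL : Language Bool} (hTL : TL ∈ Classes.P) : pbitF TL ∈ FP := comp_mem_FP (pbitJF_mem_FP hTL) (fanoutFn_mem_FP fstF_mem_FP aF_mem_FP)

/-- Value of `pbitF`. [folklore] -/
theorem pbitF_apply {TL : Language Bool} {q ℓ m i t₁ T : ℕ} (hq : 0 < q) (hT : 2 ^ ℓ ≤ T) (hi : i < m) (f z w : List Bool)
    (hz : z.length = ℓ * q) {v : ℕ} (hv : v < 2 ^ ℓ) :
    pbitF TL (boolPair (ctxV q ℓ i t₁ T (NWStr.tables q f (LineDesign.lineDesign q ℓ m) i z ++ w.drop i)) (ones v)) =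
      [NWStr.predBit (sliceCompl TL t₁) q f (LineDesign.lineDesign q ℓ m) i z w (natBits ℓ v)] := by
  rw [pbitF, Function.comp_apply, fanoutFn_apply, fstF_boolPair, aF_apply _ hv]
  exact pbitJF_apply hq hT hi f z w _ hz

/-- The count `1^{2^ℓ}` under the ruler. [folklore] -/
def cnt2L : List Bool → List Bool := pow2F ∘ fanoutFn pR pL

/-- Value of `cnt2L` (`2^ℓ ≤ T`). [folklore] -/
theorem cnt2L_apply {q ℓ i t₁ T : ℕ} (hT : 2 ^ ℓ ≤ T) (raw : List Bool) : cnt2L (ctxV q ℓ i t₁ T raw) = ones (2 ^ ℓ) := by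
  simp only [cnt2L, Function.comp_apply, fanoutFn_apply, pR_ctxV, pL_ctxV, pow2F_apply, ones, List.length_replicate, min_eq_left hT]

/-- **The predictor's truth table** on `ctxV`: the concatenation fold of the `2^ℓ` predictor bits.
[cite: Hirahara2018, Lemma 4.6 (proof: "evaluating the entire truth table of `P^{T_b}`")] -/
def rF (TL : Language Bool) : List Bool → List Bool := runFold appF (pclipF 1 (pbitF TL)) id cnt2L

/-- `rF TL ∈ FP`. [folklore] -/
theorem rF_mem_FP {TL : Language Bool} (hTL : TL ∈ Classes.P) : rF TL ∈ FP :=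
  runFold_mem_FP appF_mem_FP (X + 0) (fun w => by simpa using length_appF_le w) (pclipF_mem_FP 1 (pbitF_mem_FP hTL)) 1
    (length_pclipF_le 1 (pbitF TL)) (PolyTimeComputable.id _) (comp_mem_FP pow2F_mem_FP (fanoutFn_mem_FP pR_mem_FP pL_mem_FP))

/-- **The truth table is `NWStr.predTable`** of the complemented slice. [cite: Hirahara2018, Lemma 4.6 (proof)] -/
theorem rF_apply {TL : Language Bool} {q ℓ m i t₁ T : ℕ} (hq : 0 < q) (hT : 2 ^ ℓ ≤ T) (hi : i < m) (f z w : List Bool)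
    (hz : z.length = ℓ * q) :
    rF TL (ctxV q ℓ i t₁ T (NWStr.tables q f (LineDesign.lineDesign q ℓ m) i z ++ w.drop i)) =
      NWStr.predTable (sliceCompl TL t₁) ℓ q f (LineDesign.lineDesign q ℓ m) i z w := by
  set raw := NWStr.tables q f (LineDesign.lineDesign q ℓ m) i z ++ w.drop i with hraw
  have hc : (cnt2L (ctxV q ℓ i t₁ T raw)).length = 2 ^ ℓ := by rw [cnt2L_apply hT]; simp [ones]
  have hlen : (cnt2L (ctxV q ℓ i t₁ T raw)).length ≤ (id (ctxV q ℓ i t₁ T raw)).length := by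
    rw [hc, id]; have := le_length_ctxV q ℓ i t₁ T raw; omega
  rw [rF, runFold_apply _ _ _ _ hlen, hc, id,
    foldAcc_pclipF (fun v _ hv => by rw [hraw, pbitF_apply hq hT hi f z w hz (by omega)]; simp), foldAcc_appF, List.nil_append]
  rw [ccat_congr (g' := fun v => [NWStr.predBit (sliceCompl TL t₁) q f (LineDesign.lineDesign q ℓ m) i z w (natBits ℓ v)])
      (fun v hv => by rw [Nat.zero_add, hraw, pbitF_apply hq hT hi f z w hz hv]),
    NWLine.ccat_singleton, NWStr.predTable]
  apply List.ext_getElem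
  · simp
  · intro v h1 h2; simp

/-! ### The payload and the program -/

/-- The header of binary numerals `⟨bin n, bin e, bin ℓ, bin q, bin i, bin idx⟩`. [cite: Hirahara2018, Lemma 4.6
(proof: "specifying `m, ℓ, d, b, c, i`"), Cor. 4.8 (proof: "a description `(M, d₀, n, ε⁻¹, i)`")] -/
def hdrN (n e ℓ q i idx : ℕ) : List Bool :=
  boolPair (encodeNat n) (boolPair (encodeNat e) (boolPair (encodeNat ℓ) (boolPair (encodeNat q) (boolPair (encodeNat i) (encodeNat idx)))))

/-- **The payload** `⟨hdr, tables ‖ w_{≥ i}⟩`. [cite: Hirahara2018, Lemma 4.6 (proof)] -/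
def payloadN (n e ℓ q i idx : ℕ) (raw : List Bool) : List Bool := boolPair (hdrN n e ℓ q i idx) raw

/-- **Length of the payload**: `|raw| + 22(log₂ B + 1) + 22` when the six numbers are `≤ B`.
[cite: Hirahara2018, Lemma 4.6 ("`∑_{j<i} 2^{|Sᵢ∩Sⱼ|} + (m − i) + … + O(log(md))`")] -/
theorem length_payloadN_le {n e ℓ q i idx B : ℕ} {raw : List Bool} (hn : n ≤ B) (he : e ≤ B) (hℓ : ℓ ≤ B) (hq : q ≤ B) (hi : i ≤ B) (hidx : idx ≤ B) :
    (payloadN n e ℓ q i idx raw).length ≤ raw.length + 22 * (Nat.log 2 B + 1) + 22 := by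
  have := NWOut.length_encodeNat_le_of_le hn; have := NWOut.length_encodeNat_le_of_le he; have := NWOut.length_encodeNat_le_of_le hℓ
  have := NWOut.length_encodeNat_le_of_le hq; have := NWOut.length_encodeNat_le_of_le hi; have := NWOut.length_encodeNat_le_of_le hidx
  simp only [payloadN, hdrN, length_boolPair]
  omega

section Program

variable (dec : List Bool → List Bool) (TL : Language Bool) (q₀ P₀ : Polynomial ℕ)

/-- The ruler `1^T`. [folklore] -/
def rulerF : List Bool → List Bool := onesPrefixFn ∘ fstF
/-- The header. [folklore] -/
def hdrF : List Bool → List Bool := fstF ∘ sndF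
/-- The raw part `tables ‖ w_{≥ i}`. [folklore] -/
def rawF : List Bool → List Bool := sndF ∘ sndF
/-- Unary expansion of numeral `k ≤ 4` under the ruler. [folklore] -/
def nU (k : ℕ) : List Bool → List Bool := binToUnaryFn ∘ fanoutFn rulerF (nthF k ∘ hdrF)
/-- Unary expansion of the last numeral `idx`. [folklore] -/
def n5U : List Bool → List Bool := binToUnaryFn ∘ fanoutFn rulerF (sndPow 4 ∘ hdrF)
/-- **The oracle budget `1^{t₁}`, `t₁ = q₀(T + P₀(n))`**, computed from the ruler (NOT a numeral: this is
what makes the bound independent of the time parameter). [cite: Hirahara2018, Lemma 4.19 (proof: "convert it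
into a query `(q, 1^{t₁})` to `T`")] -/
def t1F : List Bool → List Bool := polyFn q₀ ∘ fun w => rulerF w ++ (polyFn P₀ ∘ nU 0) w
/-- The outer context. [folklore] -/
def ctxVF : List Bool → List Bool :=
  fanoutFn (fanoutFn (nU 3) (fanoutFn (nU 2) (fanoutFn (nU 4) (fanoutFn (t1F q₀ P₀) rulerF)))) rawF
/-- The decoder's input `⟨1ᵉ, ⟨1ⁿ, r⟩⟩`. [cite: Hirahara2018, Cor. 4.8 (proof: "compute `Dec_{n,δ}(U^T(d₀))`")] -/
def decInF : List Bool → List Bool := fanoutFn (nU 1) (fanoutFn (nU 0) (rF TL ∘ ctxVF q₀ P₀))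
/-- **The reconstruction program**: entry `idx` of the decoded list of the predictor's truth table.
[cite: Hirahara2018, Cor. 4.8 (proof: "output the `i`th string of `Dec(U^T(d₀))`")] [cite: Hirahara2018, Lemma 4.9] -/
def gN : List Bool → List Bool := nthItemFn ∘ fanoutFn n5U (dec ∘ decInF TL q₀ P₀)

end Program

/-- `nthF k` is the head after `k` tails (twin of `nthF_eq_fstF_iterate` in `Complexity/MaxCutGadgetMachine.lean`,
not imported: unrelated heavy closure; librarian consolidation candidate). [folklore] -/
theorem nthF_eq_fstF_iterate (k : ℕ) : ∀ W : List Bool, nthF k W = fstF (sndF^[k] W) := by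
  induction k with
  | zero => intro W; rfl
  | succ k ih => intro W; rw [nthF, Function.comp_apply, ih, ← Function.iterate_succ_apply]

/-! ### Values on a genuine payload under a long enough ruler -/

section Values

variable (dec : List Bool → List Bool) (TL : Language Bool) (q₀ P₀ : Polynomial ℕ) (R' : List Bool) (T n e ℓ q i idx : ℕ) (raw : List Bool)

/-- The argument `⟨1^T 0 R', payload⟩`. [folklore] -/
def wN : List Bool := boolPair (ones T ++ false :: R') (payloadN n e ℓ q i idx raw)

/-- The projection `rulerF` evaluated on the reconstruction payload word. [folklore] -/
theorem rulerF_wN : rulerF (wN R' T n e ℓ q i idx raw) = ones T := by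
  simp only [rulerF, wN, Function.comp_apply, fstF_boolPair]; exact onesPrefixFn_ones_append _ _
/-- The projection `hdrF` evaluated on the reconstruction payload word. [folklore] -/
theorem hdrF_wN : hdrF (wN R' T n e ℓ q i idx raw) = hdrN n e ℓ q i idx := by simp [hdrF, wN, payloadN]
/-- The projection `rawF` evaluated on the reconstruction payload word. [folklore] -/
theorem rawF_wN : rawF (wN R' T n e ℓ q i idx raw) = raw := by simp [rawF, wN, payloadN]

variable {T n e ℓ q i idx}

/-- The projection `nU` evaluated on the reconstruction payload word. [folklore] -/
theorem nU_wN (hn : n ≤ T) (he : e ≤ T) (hℓ : ℓ ≤ T) (hq : q ≤ T) (hi : i ≤ T) (hidx : idx ≤ T) :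
    nU 0 (wN R' T n e ℓ q i idx raw) = ones n ∧ nU 1 (wN R' T n e ℓ q i idx raw) = ones e ∧ nU 2 (wN R' T n e ℓ q i idx raw) = ones ℓ ∧
    nU 3 (wN R' T n e ℓ q i idx raw) = ones q ∧ nU 4 (wN R' T n e ℓ q i idx raw) = ones i ∧ n5U (wN R' T n e ℓ q i idx raw) = ones idx := by
  simp only [nU, n5U, Function.comp_apply, fanoutFn_apply, rulerF_wN, hdrF_wN, hdrN, nthF_zero_boolPair, nthF_succ_boolPair, sndPow_succ_boolPair,
    sndPow_zero, sndF_boolPair, NWOut.binToUnary_ruler hn, NWOut.binToUnary_ruler he, NWOut.binToUnary_ruler hℓ, NWOut.binToUnary_ruler hq,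
    NWOut.binToUnary_ruler hi, NWOut.binToUnary_ruler hidx, nthF_zero, fstF_boolPair, and_self]

/-- The projection `t1F` evaluated on the reconstruction payload word. [folklore] -/
theorem t1F_wN (hn : n ≤ T) (he : e ≤ T) (hℓ : ℓ ≤ T) (hq : q ≤ T) (hi : i ≤ T) (hidx : idx ≤ T) :
    t1F q₀ P₀ (wN R' T n e ℓ q i idx raw) = ones (q₀.eval (T + P₀.eval n)) := by
  rw [t1F, Function.comp_apply, Function.comp_apply, (nU_wN R' raw hn he hℓ hq hi hidx).1, rulerF_wN, polyFn_apply, polyFn_apply]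
  simp [ones]

/-- The projection `ctxVF` evaluated on the reconstruction payload word. [folklore] -/
theorem ctxVF_wN (hn : n ≤ T) (he : e ≤ T) (hℓ : ℓ ≤ T) (hq : q ≤ T) (hi : i ≤ T) (hidx : idx ≤ T) :
    ctxVF q₀ P₀ (wN R' T n e ℓ q i idx raw) = ctxV q ℓ i (q₀.eval (T + P₀.eval n)) T raw := by
  obtain ⟨-, -, h2, h3, h4, -⟩ := nU_wN R' raw hn he hℓ hq hi hidx
  simp only [ctxVF, fanoutFn_apply, h2, h3, h4, t1F_wN q₀ P₀ R' raw hn he hℓ hq hi hidx, rulerF_wN, rawF_wN, ctxV, prm]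

/-- **The program on a genuine payload**: entry `idx` of the decoded list of the predictor's truth table for
the test "`∉ T_{t₁}`", `t₁ = q₀(T + P₀(n))`. [cite: Hirahara2018, Lemma 4.6 (proof)] [cite: Hirahara2018, Cor. 4.8 (proof)] -/
theorem gN_apply {m : ℕ} (hqpos : 0 < q) (hT : 2 ^ ℓ ≤ T) (him : i < m) (f z w : List Bool) (hz : z.length = ℓ * q)
    (hn : n ≤ T) (he : e ≤ T) (hℓ : ℓ ≤ T) (hq : q ≤ T) (hi : i ≤ T) (hidx : idx ≤ T) :
    gN dec TL q₀ P₀ (wN R' T n e ℓ q i idx (NWStr.tables q f (LineDesign.lineDesign q ℓ m) i z ++ w.drop i)) =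
      nthF idx (dec (boolPair (ones e) (boolPair (ones n)
        (NWStr.predTable (sliceCompl TL (q₀.eval (T + P₀.eval n))) ℓ q f (LineDesign.lineDesign q ℓ m) i z w)))) := by
  obtain ⟨h0, h1, -, -, -, h5⟩ := nU_wN R' (NWStr.tables q f (LineDesign.lineDesign q ℓ m) i z ++ w.drop i) hn he hℓ hq hi hidx
  rw [gN, Function.comp_apply, fanoutFn_apply, h5, Function.comp_apply, decInF, fanoutFn_apply, fanoutFn_apply, h1, h0, Function.comp_apply,
    ctxVF_wN q₀ P₀ R' _ hn he hℓ hq hi hidx, rF_apply hqpos hT him f z w hz, nthItemFn_boolPair, nthF_eq_fstF_iterate]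
  simp [ones]

end Values

/-! ### Polynomial time -/

/-- **`gN dec TL q₀ P₀ ∈ FP`** for `dec ∈ FP`, `TL ∈ P`. [cite: Hirahara2018, Lemma 4.6 (proof: "This procedure takes
time roughly `poly(m, d) + poly(2^ℓ)`")] -/
theorem gN_mem_FP {dec : List Bool → List Bool} (hdec : dec ∈ FP) {TL : Language Bool} (hTL : TL ∈ Classes.P) (q₀ P₀ : Polynomial ℕ) :
    gN dec TL q₀ P₀ ∈ FP := by
  have hruler : rulerF ∈ FP := comp_mem_FP onesPrefixFn_mem_FP fstF_mem_FP
  have hhdr : hdrF ∈ FP := comp_mem_FP fstF_mem_FP sndF_mem_FP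
  have hraw : rawF ∈ FP := comp_mem_FP sndF_mem_FP sndF_mem_FP
  have hnum : ∀ k, nU k ∈ FP := fun k => comp_mem_FP binToUnaryFn_mem_FP (fanoutFn_mem_FP hruler (comp_mem_FP (nthF_mem_FP k) hhdr))
  have hn5 : n5U ∈ FP := comp_mem_FP binToUnaryFn_mem_FP (fanoutFn_mem_FP hruler (comp_mem_FP (sndPow_mem_FP 4) hhdr))
  have ht1 : t1F q₀ P₀ ∈ FP := comp_mem_FP (polyFn_mem_FP q₀) (append_mem_FP hruler (comp_mem_FP (polyFn_mem_FP P₀) (hnum 0)))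
  have hctx : ctxVF q₀ P₀ ∈ FP :=
    fanoutFn_mem_FP (fanoutFn_mem_FP (hnum 3) (fanoutFn_mem_FP (hnum 2) (fanoutFn_mem_FP (hnum 4) (fanoutFn_mem_FP ht1 hruler)))) hraw
  have hdecIn : decInF TL q₀ P₀ ∈ FP := fanoutFn_mem_FP (hnum 1) (fanoutFn_mem_FP (hnum 0) (comp_mem_FP (rF_mem_FP hTL) hctx))
  exact comp_mem_FP nthItemFn_mem_FP (fanoutFn_mem_FP hn5 (comp_mem_FP hdec hdecIn))

/-! ### The `K^t` bound -/

/-- **Hirahara 2018, Lemma 4.6 + Cor. 4.8 (Lemma 4.9), existence half, tree form.** For every efficient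
universal machine `U`, polynomial-time decoder `dec`, language `TL ∈ P` and polynomials `q₀, P₀` there are a
constant `c₁` and a polynomial `q₁` such that: if entry `idx` of the decoded list of the predictor's truth
table for the test "`∉ T_{t₁}`" (`t₁ = q₀(T + P₀(n))`, `T = 2^{2^{|u|}+|u|+1}`; design of lines, block
`i < m`, seed `z` of length `ℓ q`, tables and bits `w_{≥ i}` as the raw payload) is `x`, and the parameters are
`≤ T`, `2^ℓ ≤ T`, then
`K^{q₁(2^{|expPad 1 u|} + |payload|)}(x) ≤ |payload| + 2|u| + c₁`,
`|payload| ≤ |tables| + (|w| − i) + O(log)` (`length_payloadN_le`) — the description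
"`∑_{j<i} 2^{|Sᵢ∩Sⱼ|} + (m − i) + … + O(log(nmd/δ))`" of Lemma 4.6/4.9, with the budget paid `O(log log t)`.
[cite: Hirahara2018, Lemma 4.6] [cite: Hirahara2018, Lemma 4.9] [cite: Hirahara2018, Lemma 4.19] -/
theorem exists_ktAt_le (U : UniversalMachine) {dec : List Bool → List Bool} (hdec : dec ∈ FP) {TL : Language Bool}
    (hTL : TL ∈ Classes.P) (q₀ P₀ : Polynomial ℕ) :
    ∃ (c₁ : ℕ) (q₁ : Polynomial ℕ), ∀ (u f z w x : List Bool) (n e ℓ q m i idx : ℕ),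
      0 < q → 2 ^ ℓ ≤ NWOut.rulerLen u → i < m → z.length = ℓ * q →
      n ≤ NWOut.rulerLen u → e ≤ NWOut.rulerLen u → ℓ ≤ NWOut.rulerLen u → q ≤ NWOut.rulerLen u → i ≤ NWOut.rulerLen u →
      idx ≤ NWOut.rulerLen u →
      nthF idx (dec (boolPair (ones e) (boolPair (ones n)
        (NWStr.predTable (sliceCompl TL (q₀.eval (NWOut.rulerLen u + P₀.eval n))) ℓ q f (LineDesign.lineDesign q ℓ m) i z w)))) = x →
      U.ktAt (q₁.eval (2 ^ (expPad 1 u).length + (payloadN n e ℓ q i idx (NWStr.tables q f (LineDesign.lineDesign q ℓ m) i z ++ w.drop i)).length)) x ≤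
        (payloadN n e ℓ q i idx (NWStr.tables q f (LineDesign.lineDesign q ℓ m) i z ++ w.drop i)).length + 2 * u.length + c₁ := by
  obtain ⟨c₁, q₁, h⟩ := U.exists_ktAt_le_of_FP₂ (gN_mem_FP hdec hTL q₀ P₀)
  refine ⟨c₁, q₁, fun u f z w x n e ℓ q m i idx hq hT him hz hn he hℓ hqT hi hidx hx => ?_⟩
  have hg := h u (payloadN n e ℓ q i idx (NWStr.tables q f (LineDesign.lineDesign q ℓ m) i z ++ w.drop i))
  rwa [NWOut.expPad_one_expPad_one_eq, show boolPair (ones (NWOut.rulerLen u) ++ false :: expPad 1 u)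
      (payloadN n e ℓ q i idx (NWStr.tables q f (LineDesign.lineDesign q ℓ m) i z ++ w.drop i)) =
      wN (expPad 1 u) (NWOut.rulerLen u) n e ℓ q i idx (NWStr.tables q f (LineDesign.lineDesign q ℓ m) i z ++ w.drop i) from rfl,
    gN_apply dec TL q₀ P₀ (expPad 1 u) hq hT him f z w hz hn he hℓ hqT hi hidx, hx] at hg

end NWRec

end Literature.Computability.MetaComplexity

end
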